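import Summits.Ventures.PercRepro.C025ProfileGirthPredHallA

/-!
# THE ROWS `(q, u)` AT GIRTH `≥ u − 1` — PART D: THE HALL FORM AT EVERY RANK (night-3 g19)

The missing rank `v + 2` of part B's Hall form splits in two:
* no coloop (`two_le_card_out_of_no_coloop`: a `(v+2)`-set of rank `v + 1` with one point outside its closure makes
  that point a coloop) — then part C's `hallIneq_of_girth_pred_out`;
* a coloop `c` (**`hallIneq_of_girth_pred_of_coloop`**): a priced member avoids `c` and has price `1`
  (`C(v+2+q, v+2)/C(v+2+q, q)`), the Boolean normalized matching property on `E ∖ c` from the level `q` to the level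
  `v + 1` (`choose_le_choose_of_le_of_add_le`: `C(n′, q) ≤ C(n′, v+1)` as `v + 1 + q ≤ n′`), and the injection
  `S ↦ S ∪ {c}` (independent `S`) / `S ↦ S ∪ {y_S, c}` (`S` of rank `v`, `y_S ∈ E ∖ c` outside `cl S`; g18's
  `eq_of_insert_eq_of_girth`) of the Boolean shadow into the matroid shadow at the level `v + 2`.
**`hallIneq_of_girth_pred`** `(hg : ∀ T ⊆ M.E, T.encard ≤ v → M.Indep T) (hqv : q + 1 ≤ v) : Profile.HallIneq M q (v + 2)`
— C-033 at the row `(q, u)`, `u = v + 2`, `q ≤ u − 3`, on EVERY finite matroid of girth `≥ u − 1`, every rank;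
`hallIneq_of_girth_pred_every (q u) (hqu : q + 3 ≤ u) (hg : ∀ T ⊆ M.E, T.encard + 2 ≤ u → M.Indep T) :
Profile.HallIneq M q u`; `profileIneq_and_hallIneq_of_girth_pred`.
No `def`, no `instance`, no notation.  Axioms: standard.
-/

open scoped Matroid

namespace PercRepro

open Set Finset ThmH Staged

namespace GirthRows

variable {α : Type} [DecidableEq α] {M : Matroid α} [M.Finite]

open scoped Classical

/-- **The Hall form `(H⁺_{q, v+2})` at rank `v + 2` with a coloop `c`** (girth `≥ v + 1`, `q + 1 ≤ v`): every priced
member avoids `c` and has price `1`; the Boolean normalized matching property on `E ∖ c` at the level `v + 1` and the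
injection `S ↦ S ∪ {c}` / `S ↦ S ∪ {y_S, c}` into the matroid shadow at the level `v + 2` finish. -/
theorem hallIneq_of_girth_pred_of_coloop {q v : ℕ} (hg : ∀ T ⊆ M.E, T.encard ≤ v → M.Indep T) (hqv : q + 1 ≤ v)
    (hE : M.eRank = ((v + 2 : ℕ) : ℕ∞)) {c : α} (hc : c ∈ gr M) (hcr : rkN M ((gr M).erase c) = v + 1) :
    Profile.HallIneq M q (v + 2) := by
  intro 𝒜 h𝒜
  classical
  set E' := (gr M).erase c with hE'
  have hE'g : E' ⊆ gr M := Finset.erase_subset c (gr M)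
  have hE'E : (E' : Set α) ⊆ M.E := by rw [← coe_gr]; exact_mod_cast hE'g
  have hcE : c ∈ M.E := by rw [← coe_gr M]; exact Finset.mem_coe.2 hc
  have hnotMem : ∀ S : Finset α, S ⊆ gr M → ∀ y, y ∉ M.closure (S : Set α) → y ∉ S := by
    intro S hSg y hy h
    exact hy (M.subset_closure (S : Set α) (by rw [← coe_gr]; exact_mod_cast hSg) (Finset.mem_coe.2 h))
  -- a set avoiding `c` of rank `v + 1` becomes spanning with `c`: `c ∉ cl X` for `X ⊆ E'`
  have hc_notMem_closure : ∀ X : Finset α, X ⊆ E' → c ∉ M.closure (X : Set α) := by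
    intro X hX hcX
    have hXcl : M.closure (X : Set α) ⊆ M.closure (E' : Set α) := M.closure_subset_closure (Finset.coe_subset.2 hX)
    have hcl : c ∈ M.closure (E' : Set α) := hXcl hcX
    have hgr : ((gr M : Finset α) : Set α) ⊆ M.closure (E' : Set α) := by
      intro x hx
      by_cases hxc : x = c
      · rw [hxc]; exact hcl
      · exact M.subset_closure (E' : Set α) hE'E (Finset.mem_coe.2 (Finset.mem_erase.2 ⟨hxc, Finset.mem_coe.1 hx⟩))
    have h1 : M.eRk ((gr M : Finset α) : Set α) ≤ M.eRk (E' : Set α) := by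
      calc M.eRk ((gr M : Finset α) : Set α) ≤ M.eRk (M.closure (E' : Set α)) := M.eRk_mono hgr
        _ = M.eRk (E' : Set α) := M.eRk_closure_eq _
    rw [← Staged.coe_rkN, ← Staged.coe_rkN, hcr] at h1
    have hgrk : rkN M (gr M) = v + 2 := Staged.rkN_eq_iff.2 (by rw [coe_gr, Matroid.eRk_ground, hE])
    rw [hgrk] at h1
    have : v + 2 ≤ v + 1 := by exact_mod_cast h1
    omega
  -- the priced members: avoid `c`, price `1`
  set 𝒜' := 𝒜.filter (fun B => Profile.price M q (v + 2) B ≠ 0) with h𝒜'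
  have hfacts : ∀ B ∈ 𝒜', c ∉ B ∧ Profile.price M q (v + 2) B = 1 := by
    intro B hB
    rw [h𝒜', Finset.mem_filter] at hB
    obtain ⟨hB𝒜, hBne⟩ := hB
    obtain ⟨hBg, _⟩ := Profile.mem_Rq.1 (h𝒜 hB𝒜)
    have hthr : ((v + 2 : ℕ) : ℕ∞) ≤ M.eRk ((gr M \ B : Finset α) : Set α) := by
      by_contra hcon
      apply hBne
      unfold Profile.price
      rw [if_neg hcon]
    have hcB : c ∉ B := by
      intro hcB
      have hsub : (gr M \ B : Finset α) ⊆ E' := by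
        intro x hx
        rw [Finset.mem_sdiff] at hx
        exact Finset.mem_erase.2 ⟨fun h => hx.2 (h ▸ hcB), hx.1⟩
      have h1 : M.eRk ((gr M \ B : Finset α) : Set α) ≤ M.eRk (E' : Set α) := M.eRk_mono (Finset.coe_subset.2 hsub)
      rw [← Staged.coe_rkN (E'), hcr] at h1
      have h2 := hthr.trans h1
      have : v + 2 ≤ v + 1 := by exact_mod_cast h2
      omega
    refine ⟨hcB, ?_⟩
    have hle : M.eRk ((gr M \ B : Finset α) : Set α) ≤ ((v + 2 : ℕ) : ℕ∞) := hE ▸ M.eRk_le_eRank _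
    have heq : M.eRk ((gr M \ B : Finset α) : Set α) = ((v + 2 : ℕ) : ℕ∞) := le_antisymm hle hthr
    unfold Profile.price
    rw [if_pos hthr, heq, ENat.toNat_coe]
    have hpos : (0 : ℚ) < (Nat.choose (v + 2 + q) q : ℚ) := by
      exact_mod_cast Nat.choose_pos (by omega)
    rw [Nat.choose_symm_add (a := v + 2) (b := q)]
    exact div_self hpos.ne'
  have hsum : ∑ B ∈ 𝒜, Profile.price M q (v + 2) B = ∑ B ∈ 𝒜', Profile.price M q (v + 2) B :=
    (Finset.sum_filter_ne_zero _).symm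
  have hone : ∑ B ∈ 𝒜', Profile.price M q (v + 2) B = (𝒜'.card : ℚ) := by
    rw [Finset.card_eq_sum_ones, Nat.cast_sum]
    apply Finset.sum_congr rfl
    intro B hB
    rw [(hfacts B hB).2]
    simp
  rw [hsum, hone]
  -- the members of `𝒜'` are `q`-subsets of `E'`
  have hAq : 𝒜' ⊆ E'.powersetCard q := by
    intro B hB
    have hB𝒜 : B ∈ 𝒜 := (Finset.mem_filter.1 hB).1
    have h := Finset.mem_powersetCard.1 (Rq_subset_powersetCard hg (by omega) (h𝒜 hB𝒜))
    rw [Finset.mem_powersetCard]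
    refine ⟨?_, h.2⟩
    intro x hx
    exact Finset.mem_erase.2 ⟨fun hxc => (hfacts B hB).1 (hxc ▸ hx), h.1 hx⟩
  by_cases hAe : 𝒜' = ∅
  · rw [hAe, Finset.card_empty]
    exact_mod_cast Nat.zero_le _
  -- a priced member exists, so `E'` has at least `v + 1 + q` points
  obtain ⟨B₀, hB₀⟩ := Finset.nonempty_iff_ne_empty.2 hAe
  have hn : v + 1 + q ≤ E'.card := by
    have hB₀𝒜 : B₀ ∈ 𝒜 := (Finset.mem_filter.1 hB₀).1
    have hB₀ne := (Finset.mem_filter.1 hB₀).2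
    have hthr : ((v + 2 : ℕ) : ℕ∞) ≤ M.eRk ((gr M \ B₀ : Finset α) : Set α) := by
      by_contra hcon
      apply hB₀ne
      unfold Profile.price
      rw [if_neg hcon]
    have h1 : M.eRk ((gr M \ B₀ : Finset α) : Set α) ≤ ((gr M \ B₀ : Finset α) : Set α).encard := M.eRk_le_encard _
    rw [Set.encard_coe_eq_coe_finsetCard] at h1
    have h2 : v + 2 ≤ (gr M \ B₀).card := by exact_mod_cast hthr.trans h1
    have h3 := Finset.mem_powersetCard.1 (hAq hB₀)
    have h4 : (gr M \ B₀).card = (gr M).card - B₀.card :=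
      Finset.card_sdiff_of_subset (h3.1.trans hE'g)
    have h5 : E'.card = (gr M).card - 1 := Finset.card_erase_of_mem hc
    have h6 : 0 < (gr M).card := Finset.card_pos.2 ⟨c, hc⟩
    omega
  -- the Boolean normalized matching property on `E'` from the level `q` to the level `v + 1`
  obtain ⟨k, hk⟩ : ∃ k, v + 1 = q + k := ⟨v + 1 - q, by omega⟩
  have hnmp := Boolean.card_mul_choose_le_card_upAt_mul_choose hAq k
  rw [← hk] at hnmp
  have hchoose : Nat.choose E'.card q ≤ Nat.choose E'.card (v + 1) :=
    choose_le_choose_of_le_of_add_le (by omega) (by omega)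
  have hcard : 𝒜'.card ≤ (Boolean.upAt E' (v + 1) 𝒜').card := by
    have hpos : 0 < Nat.choose E'.card q := Nat.choose_pos (by omega)
    by_contra hcon
    have h1 : (Boolean.upAt E' (v + 1) 𝒜').card < 𝒜'.card := by omega
    have h2 : (Boolean.upAt E' (v + 1) 𝒜').card * Nat.choose E'.card q < 𝒜'.card * Nat.choose E'.card q :=
      Nat.mul_lt_mul_of_pos_right h1 hpos
    have h3 : 𝒜'.card * Nat.choose E'.card q ≤ 𝒜'.card * Nat.choose E'.card (v + 1) :=
      Nat.mul_le_mul_left _ hchoose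
    omega
  -- the injection of the Boolean shadow at the level `v + 1` into the matroid shadow at the level `v + 2`
  set P := Boolean.upAt E' (v + 1) 𝒜' with hP
  have hPmem : ∀ S ∈ P, S ⊆ E' ∧ S.card = v + 1 ∧ ∃ B ∈ 𝒜, B ⊆ S := by
    intro S hS
    rw [hP, Boolean.mem_upAt] at hS
    obtain ⟨B, hB, hBS⟩ := hS.2
    exact ⟨hS.1.1, hS.1.2, B, (Finset.mem_filter.1 hB).1, hBS⟩
  set I := P.filter (fun S : Finset α => M.Indep (S : Set α)) with hI
  set D := P.filter (fun S : Finset α => ¬ M.Indep (S : Set α)) with hD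
  have hID : I.card + D.card = P.card := by
    rw [hI, hD]
    exact Finset.card_filter_add_card_filter_not _
  have hDrk : ∀ S ∈ D, rkN M S = v := by
    intro S hS
    rw [hD, Finset.mem_filter] at hS
    obtain ⟨hSE', hSc, _⟩ := hPmem S hS.1
    exact rkN_eq_of_dep_of_girth hg (hSE'.trans hE'g) hSc hS.2
  have hex : ∀ S ∈ D, ∃ y ∈ E', y ∉ M.closure (S : Set α) := by
    intro S hS
    apply exists_mem_notMem_closure_of_rkN_lt
    rw [hDrk S hS, hcr]
    omega
  let g : Finset α → Finset α := fun S =>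
    if h : ∃ y ∈ E', y ∉ M.closure (S : Set α) then insert c (insert h.choose S) else insert c S
  have hgD : ∀ S ∈ D, ∃ y, y ∈ E' ∧ y ∉ M.closure (S : Set α) ∧ y ∉ S ∧ g S = insert c (insert y S) := by
    intro S hS
    have h := hex S hS
    refine ⟨h.choose, h.choose_spec.1, h.choose_spec.2, ?_, dif_pos h⟩
    exact hnotMem S ((hPmem S (Finset.mem_filter.1 hS).1).1.trans hE'g) _ h.choose_spec.2
  have hgI : ∀ S ∈ I, g S = insert c S := by
    intro S hS
    rw [hI, Finset.mem_filter] at hS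
    have hSE' := (hPmem S hS.1).1
    simp only [g]
    split_ifs with h
    · exfalso
      -- an independent `(v+1)`-subset of `E'` spans `E'`: no point of `E'` is outside its closure
      obtain ⟨hSc, _⟩ := (hPmem S hS.1).2
      have hSr : rkN M S = v + 1 := by
        rw [Staged.rkN_eq_iff, hS.2.eRk_eq_encard, Set.encard_coe_eq_coe_finsetCard, hSc]
      obtain ⟨y, hyE', hyc⟩ := h
      have h1 : rkN M (insert y S) = v + 2 := by
        rw [rkN_insert_of_notMem_closure (hE'g hyE') hyc, hSr]
      have h2 : rkN M (insert y S) ≤ rkN M E' :=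
        Staged.rkN_mono (Finset.insert_subset hyE' hSE')
      rw [hcr] at h2
      omega
    · rfl
  -- images lie in the shadow at the level `v + 2`
  have hmem_shadow : ∀ S ∈ P, ∀ X : Finset α, S ⊆ X → X ⊆ gr M → rkN M X = v + 2 →
      X ∈ Shadow.shadowLevel M (v + 2) 𝒜 := by
    intro S hS X hSX hXg hXr
    obtain ⟨_, _, B, hB, hBS⟩ := hPmem S hS
    rw [mem_shadowLevel, Profile.mem_levelSet]
    refine ⟨⟨hXg, ?_⟩, B, hB, hBS.trans hSX⟩
    rw [← Staged.coe_rkN, hXr]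
  have hI_img : ∀ S ∈ I, g S ∈ Shadow.shadowLevel M (v + 2) 𝒜 := by
    intro S hS
    rw [hgI S hS]
    have hS' := (Finset.mem_filter.1 hS)
    obtain ⟨hSE', hSc, _⟩ := hPmem S hS'.1
    have hSr : rkN M S = v + 1 := by
      rw [Staged.rkN_eq_iff, hS'.2.eRk_eq_encard, Set.encard_coe_eq_coe_finsetCard, hSc]
    apply hmem_shadow S hS'.1 _ (Finset.subset_insert c S) (Finset.insert_subset hc (hSE'.trans hE'g))
    rw [rkN_insert_of_notMem_closure hc (hc_notMem_closure S hSE'), hSr]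
  have hD_img : ∀ S ∈ D, g S ∈ Shadow.shadowLevel M (v + 2) 𝒜 := by
    intro S hS
    obtain ⟨y, hyE', hyc, hyS, hgy⟩ := hgD S hS
    rw [hgy]
    have hSP := (Finset.mem_filter.1 hS).1
    obtain ⟨hSE', _, _⟩ := hPmem S hSP
    have hyS_sub : insert y S ⊆ E' := Finset.insert_subset hyE' hSE'
    apply hmem_shadow S hSP _ ((Finset.subset_insert y S).trans (Finset.subset_insert c _))
      (Finset.insert_subset hc (hyS_sub.trans hE'g))
    rw [rkN_insert_of_notMem_closure hc (hc_notMem_closure _ hyS_sub),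
      rkN_insert_of_notMem_closure (hE'g hyE') hyc, hDrk S hS]
  -- injectivity
  have hcI : ∀ S ∈ P, c ∉ S := fun S hS h => (Finset.mem_erase.1 ((hPmem S hS).1 h)).1 rfl
  have hinjI : Set.InjOn g (I : Set (Finset α)) := by
    intro S hS S' hS' hSS'
    rw [Finset.mem_coe] at hS hS'
    rw [hgI S hS, hgI S' hS'] at hSS'
    have h1 : S = (insert c S).erase c := (Finset.erase_insert (hcI S (Finset.mem_filter.1 hS).1)).symm
    have h2 : S' = (insert c S').erase c := (Finset.erase_insert (hcI S' (Finset.mem_filter.1 hS').1)).symm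
    rw [h1, h2, hSS']
  have hinjD : Set.InjOn g (D : Set (Finset α)) := by
    intro S hS S' hS' hSS'
    rw [Finset.mem_coe] at hS hS'
    obtain ⟨y, hyE', hyc, hyS, hgy⟩ := hgD S hS
    obtain ⟨y', hy'E', _, hy'S', hgy'⟩ := hgD S' hS'
    rw [hgy, hgy'] at hSS'
    have hcy : c ∉ insert y S := by
      intro h
      rcases Finset.mem_insert.1 h with h | h
      · exact (Finset.mem_erase.1 hyE').1 h.symm
      · exact hcI S (Finset.mem_filter.1 hS).1 h
    have hcy' : c ∉ insert y' S' := by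
      intro h
      rcases Finset.mem_insert.1 h with h | h
      · exact (Finset.mem_erase.1 hy'E').1 h.symm
      · exact hcI S' (Finset.mem_filter.1 hS').1 h
    have hyy' : insert y S = insert y' S' := by
      rw [← Finset.erase_insert hcy, ← Finset.erase_insert hcy', hSS']
    obtain ⟨hSE', hSc, _⟩ := hPmem S (Finset.mem_filter.1 hS).1
    obtain ⟨_, hS'c, _⟩ := hPmem S' (Finset.mem_filter.1 hS').1
    have hT : rkN M (insert y S) = v + 1 := by
      rw [rkN_insert_of_notMem_closure (hE'g hyE') hyc, hDrk S hS]
    exact eq_of_insert_eq_of_girth hg (hSE'.trans hE'g) hSc hS'c (hDrk S hS) (hDrk S' hS') hyS hy'S' hT hyy'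
  have hdisj : Disjoint (I.image g) (D.image g) := by
    rw [Finset.disjoint_left]
    intro X hXI hXD
    rw [Finset.mem_image] at hXI hXD
    obtain ⟨S, hS, rfl⟩ := hXI
    obtain ⟨S', hS', hS'X⟩ := hXD
    obtain ⟨y, hyE', _, hyS', hgy'⟩ := hgD S' hS'
    have hSc := (hPmem S (Finset.mem_filter.1 hS).1).2.1
    have hS'c := (hPmem S' (Finset.mem_filter.1 hS').1).2.1
    have h1 : (g S).card = v + 2 := by
      rw [hgI S hS, Finset.card_insert_of_notMem (hcI S (Finset.mem_filter.1 hS).1), hSc]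
    have hcy : c ∉ insert y S' := by
      intro h
      rcases Finset.mem_insert.1 h with h | h
      · exact (Finset.mem_erase.1 hyE').1 h.symm
      · exact hcI S' (Finset.mem_filter.1 hS').1 h
    have h2 : (g S').card = v + 3 := by
      rw [hgy', Finset.card_insert_of_notMem hcy, Finset.card_insert_of_notMem hyS', hS'c]
    rw [hS'X] at h2
    omega
  calc (𝒜'.card : ℚ) ≤ (P.card : ℚ) := by exact_mod_cast hcard
    _ = ((I.card + D.card : ℕ) : ℚ) := by rw [hID]
    _ = (((I.image g) ∪ (D.image g)).card : ℚ) := by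
        rw [Finset.card_union_of_disjoint hdisj, Finset.card_image_of_injOn hinjI, Finset.card_image_of_injOn hinjD]
    _ ≤ ((Shadow.shadowLevel M (v + 2) 𝒜).card : ℚ) := by
        apply Nat.cast_le.2
        apply Finset.card_le_card
        apply Finset.union_subset
        · rw [Finset.image_subset_iff]; exact hI_img
        · rw [Finset.image_subset_iff]; exact hD_img

/-- **THE HALL FORM `(H⁺_{q, v+2})` AT GIRTH `≥ v + 1`, EVERY RANK** (`q + 1 ≤ v`): C-033 at the row `(q, u)`, `u = v + 2`,
`q ≤ u − 3`, on every finite matroid in which every set of at most `u − 2` points is independent — rank `≠ v + 2` by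
part B, rank `v + 2` by the coloop case or by the double count without coloops. -/
theorem hallIneq_of_girth_pred {q v : ℕ} (hg : ∀ T ⊆ M.E, T.encard ≤ v → M.Indep T) (hqv : q + 1 ≤ v) :
    Profile.HallIneq M q (v + 2) := by
  by_cases hne : M.eRank ≠ ((v + 2 : ℕ) : ℕ∞)
  · exact hallIneq_of_girth_pred_of_ne hg hqv hne
  · have hE : M.eRank = ((v + 2 : ℕ) : ℕ∞) := not_ne_iff.1 hne
    have hgrk : rkN M (gr M) = v + 2 := Staged.rkN_eq_iff.2 (by rw [coe_gr, Matroid.eRk_ground, hE])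
    by_cases h : ∃ c ∈ gr M, rkN M ((gr M).erase c) ≤ v + 1
    · obtain ⟨c, hc, hcr⟩ := h
      have hcr' : rkN M ((gr M).erase c) = v + 1 := by
        have := rkN_le_rkN_erase_add_one (M := M) (T := gr M) c
        omega
      exact hallIneq_of_girth_pred_of_coloop hg hqv hE hc hcr'
    · have hnc : ∀ y ∈ gr M, rkN M ((gr M).erase y) = v + 2 := by
        intro y hy
        have h1 : rkN M ((gr M).erase y) ≤ rkN M (gr M) := Staged.rkN_mono (Finset.erase_subset y (gr M))
        have h2 : ¬ rkN M ((gr M).erase y) ≤ v + 1 := fun h' => h ⟨y, hy, h'⟩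
        omega
      exact hallIneq_of_girth_pred_out hg (by rw [hE]) (fun S _ _ hSr => two_le_card_out_of_no_coloop hE hnc hSr) hqv

/-- C-033 at every row `(q, u)` with `q + 3 ≤ u` on every finite matroid of girth `≥ u − 1` (every set of at most
`u − 2` points independent). -/
theorem hallIneq_of_girth_pred_every (q u : ℕ) (hqu : q + 3 ≤ u)
    (hg : ∀ T ⊆ M.E, T.encard + 2 ≤ u → M.Indep T) : Profile.HallIneq M q u := by
  obtain ⟨v, rfl⟩ : ∃ v, u = v + 2 := ⟨u - 2, by omega⟩
  have hg' : ∀ T ⊆ M.E, T.encard ≤ v → M.Indep T := by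
    intro T hT hTv
    apply hg T hT
    have h1 : T.encard + 2 ≤ (v : ℕ∞) + 2 := by gcongr
    refine h1.trans ?_
    norm_cast
  exact hallIneq_of_girth_pred hg' (by omega)

/-- The row `(q, v + 2)` of `(Π)` and its Hall form together at girth `≥ v + 1`, `q + 1 ≤ v`, every rank. -/
theorem profileIneq_and_hallIneq_of_girth_pred {q v : ℕ} (hg : ∀ T ⊆ M.E, T.encard ≤ v → M.Indep T)
    (hqv : q + 1 ≤ v) : Profile.ProfileIneq M q (v + 2) ∧ Profile.HallIneq M q (v + 2) :=
  ⟨profileIneq_of_girth_pred hg hqv, hallIneq_of_girth_pred hg hqv⟩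

end GirthRows

end PercRepro
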